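import Summits.AtomisticToContinuum.Crystallization.Theorems.ExcessDecayLiouvilleChainFacts
import Summits.AtomisticToContinuum.Crystallization.Theorems.ExcessDecayLiouvilleScaleMasses

/-!
# Route `ExcessDecayLiouville`: the invariant of the chain propagates across one scale (nonlinear half, XL)

Harmonic-replacement architecture for item `ExcessDecay` (stmt-AtomisticToContinuum-9334), nonlinear half.
`chain_step`: from `ChainInv` at `(σ, γ, U, Vb)` (and the scale-independent chain hypotheses) to `ChainInv` at
`(σ/(4L¹⁰), L¹⁰γ, U + sAgg, Vb + vAgg)` for the output `aff + T + 𝟙_{S₀}ξ` of `inv_scale_step`: the increments in the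
root variables (`ScaleArithJump`), the fresh masses on `[σ²/(16L²⁰), σ²]` (`fresh_mass_le` + `fresh_total_le`), the
propagated masses on `[σ², r/4]` (`propagated_mass_le` + `propagated_le`), and the two budget potentials
(`potU_step`, `potV_step`).
All `[folklore]`; helper lemmas, nothing here closes an item.
-/

noncomputable section

namespace Summit.AtomisticToContinuum.Crystallization.Theorems.ExcessDecayLiouville

open scoped BigOperators Topology InnerProductSpace RealInnerProductSpace Classical
open Literature.MathematicalPhysics.StatisticalMechanics
open Summit.AtomisticToContinuum.Crystallization.Theorems.PhononStabilityNegative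

local notation "E3" => EuclideanSpace ℝ (Fin 3)

-- Local notation: the force-constant map `K(e)w = h(|e|²)w + 2⟪e,w⟫h′(|e|²)e`.
local notation3 "𝕂[" e "] " w:max =>
  (-((‖e‖ ^ 2)⁻¹) ^ 7 + ((‖e‖ ^ 2)⁻¹) ^ 4) • w + (2 * ⟪e, w⟫ * (7 * ((‖e‖ ^ 2)⁻¹) ^ 8 - 4 * ((‖e‖ ^ 2)⁻¹) ^ 5)) • e
-- Local notation: the pair force `F(x) = h(|x|²) x`.
local notation3 "𝐅[" x "]" => ((-((‖x‖ ^ 2)⁻¹) ^ 7 + ((‖x‖ ^ 2)⁻¹) ^ 4) • x)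
set_option quotPrecheck false in
-- Local notation: ball indicator.
local notation "𝟙ᵇ[" x ", " c ", " R "]" => (if dist (x : EuclideanSpace ℝ (Fin 3)) c ≤ R then (1 : ℝ) else 0)

section

variable {X : Set E3} {c : E3} {r ε δ κ : ℝ} {t : Fin 2 → E3} {A : E3 →L[ℝ] E3} {π : E3 → E3}
  {aff₀ aff : E3 → E3} {a : Fin 2 → E3} {B : E3 →L[ℝ] E3} {c₀ : E3}

variable (hA : Adm₀ A) (hI : Inner₀ t A)

set_option quotPrecheck false in
-- Local notation: the operator row `(L v)(p)`.
local notation "𝕃" v:max " @ " p:max =>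
  tsum (fun q : Sites₀ t A => (if ((p : Sites₀ t A) : E3) ≠ q then 𝕂[((p : Sites₀ t A) : E3) - q] (v ((p : Sites₀ t A) : E3) - v q) else 0))
set_option quotPrecheck false in
-- Local notation: the finite near-neighbour form on the ball of radius `X` about `c₀`.
local notation "NN[" v ", " X "]" =>
  (∑ p ∈ (finite_sites_dist_le (t := t) (A := A) hA hI c₀ X).toFinset,
    ∑ q ∈ (finite_sites_dist_le (t := t) (A := A) hA hI c₀ X).toFinset,
      (if p ≠ q ∧ dist p q ≤ 11 / 10 then ‖v p - v q‖ ^ 2 else (0 : ℝ)))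
set_option quotPrecheck false in
-- local mass on the ball of radius `X` about `c₀`
local notation "𝐌[" f ", " X "]" =>
  tsum (fun p : Sites₀ t A => ‖f (p : E3)‖ ^ 2 * 𝟙ᵇ[p, c₀, X])
set_option quotPrecheck false in
-- Local notation: the displaced self-force `G(p)` of the background `aff`.
local notation "𝐆[" aff "] " p:max =>
  tsum (fun q : Sites₀ t A => (if (p : E3) ≠ q then 𝐅[((p : E3) - q) + (aff (p : E3) - aff q)] else 0))
set_option quotPrecheck false in
-- Local notation: the radial site cut-off `= 1` on the sites of `B_{r₁}(c)`, `0` beyond `r₁ + w`, slope `1/w`.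
local notation "𝛘[" r₁ ", " w "]" =>
  (fun x : EuclideanSpace ℝ (Fin 3) => (if x ∈ Sites₀ t A then max (min 1 ((r₁ + w - dist x c) / w)) 0 else 0))

/-- Bookkeeping: the value increment from the step values and the slope increment. [folklore] -/
theorem va_budget {x sq b L V S : ℝ} (h : x ≤ sq + 11 / 10 * b) (hsq : sq ≤ L ^ 8 * V) (hb : b ≤ 12 * L ^ 8 * S) :
    x ≤ L ^ 8 * V + (66 / 5) * L ^ 8 * S := by
  linarith

/-- Bookkeeping: the displacement budget propagates across one scale. [folklore] -/
theorem disp_budget {n₁ n₂ L d S V U Vb : ℝ} (hL : 0 ≤ L) (hS : 0 ≤ S)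
    (h1 : n₁ ≤ L ^ 8 * Vb + (L ^ 13 + 14 * L ^ 8 + 12 * L ^ 8 * (d + 11 / 10)) * U)
    (h2 : n₂ ≤ (L ^ 8 * V + (66 / 5) * L ^ 8 * S) + 12 * L ^ 8 * S * (d + 11 / 10) + L ^ 13 * S) :
    n₁ + n₂ ≤ L ^ 8 * (Vb + V) + (L ^ 13 + 14 * L ^ 8 + 12 * L ^ 8 * (d + 11 / 10)) * (U + S) := by
  have h0 : 0 ≤ L ^ 8 * S := mul_nonneg (pow_nonneg hL 8) hS
  nlinarith [h0, h1, h2]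

-- thirteen conjuncts of the invariant, each from a landed one-scale lemma; ~6·10⁵ heartbeats
set_option maxHeartbeats 800000 in
include hA hI in
/-- **The chain invariant propagates across one scale** (see the module docstring). [folklore] -/
theorem chain_step (hκ0 : 0 < κ) (hκ1 : κ ≤ 1)
    (hκ : ∀ v : E3 → E3, (Function.support v).Finite →
      Function.support v ⊆ Sites₀ t A → κ * nnForm t A v ≤ ∑' p : Sites₀ t A, ⟪𝕃 v @ p, v p⟫)
    (hX : X.Finite) (hsep : Sep₀ X δ) (hequil : Equil₀ X) (hδ : 0 < δ) (hδ1 : δ ≤ 1)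
    (hε0 : 0 ≤ ε) (hε : 2 * ε < δ) (hr : 192 ≤ r)
    (hXb : ∀ p ∈ X, dist p c ≤ r → ∃ m : Fin 2, ∃ z ∈ Λ₀, dist p (t m + A z) ≤ ε)
    (hπ : ∀ s' ∈ Sites₀ t A, dist s' c ≤ r → π s' ∈ X ∧ dist (π s') s' ≤ ε)
    (hinj : ∀ s₁ ∈ Sites₀ t A, ∀ s₂ ∈ Sites₀ t A, dist s₁ c ≤ r → dist s₂ c ≤ r → π s₁ = π s₂ → s₁ = s₂)
    (SR : Finset E3) (hSR : ∀ x, x ∈ SR ↔ x ∈ Sites₀ t A ∧ dist x c ≤ r) (hc₀ : dist c₀ c ≤ r / 8)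
    -- chain constants
    {Du ν Λs σ₀ γ₀ Ustar Vstar b₀ j₀ Du₀ : ℝ} (hDu0 : 0 ≤ Du) (hDu1 : Du ≤ 1 / 20) (hν : 0 ≤ ν) (hγ₀ : 0 ≤ γ₀)
    {ja jb : ℝ} (hN : ntotGen κ r δ ε Du ja jb ≤ ν ^ 2 * r ^ 7)
    (Cja : j₀ + 2 * lcOf κ ^ 13 * (Ustar + Du / r ^ 2) ≤ ja) (hja : ja ≤ 1 / 100)
    (Cjb : b₀ + 12 * lcOf κ ^ 8 * (Ustar + Du / r ^ 2) ≤ jb)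
    (CΛ : 4000000 * (210000 * ((25 / 23) * (2 * Du + ja) + jb)) ≤ κ / 12)
    (hσ₀r : 737600 * σ₀ ^ 2 + 153600 ≤ r)
    (hDu₀ : ∀ x ∈ SR, ‖(π x - x) - aff₀ x‖ ≤ Du₀)
    (C1 : lcOf κ ^ 13 * (Ustar / 2 + Du / (4 * r ^ 2)) ≤ κ ^ 2 / 10 ^ 11)
    (C2a : j₀ + 2 * lcOf κ ^ 13 * (Ustar + Du / r ^ 2) ≤ κ / (2 * 10 ^ 10))
    (C2b : b₀ + 12 * lcOf κ ^ 8 * (Ustar + Du / r ^ 2) ≤ κ / (2 * 10 ^ 10))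
    (C2c : 2 * r * (b₀ + 12 * lcOf κ ^ 8 * (Ustar + Du / r ^ 2)) ≤ 1 / 100)
    (C3 : Du₀ + lcOf κ ^ 8 * Vstar +
      (lcOf κ ^ 13 + 14 * lcOf κ ^ 8 + 12 * lcOf κ ^ 8 * (5 * r / 4 + 11 / 10)) * (Ustar + Du / r ^ 2) ≤ Du)
    (C4a : 4000000 * lamOf Du (j₀ + 2 * lcOf κ ^ 13 * (Ustar + Du / r ^ 2)) (b₀ + 12 * lcOf κ ^ 8 * (Ustar + Du / r ^ 2)) ≤ κ / 16)
    (C4b : lamOf Du (j₀ + 2 * lcOf κ ^ 13 * (Ustar + Du / r ^ 2)) (b₀ + 12 * lcOf κ ^ 8 * (Ustar + Du / r ^ 2)) ≤ Λs)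
    (C4c : lcOf κ ^ 113 * Λs ^ 2 ≤ 1)
    (C5 : lcOf κ ^ 114 * floorAgg σ₀ (phiOf Du r δ) ν Du r ≤ γ₀ ^ 2)
    {σ γ U Vb : ℝ}
    (hinv : ChainInv t A π c r c₀ aff₀ (lcOf κ) (phiOf Du r δ) ν Du Ustar Vstar b₀ j₀ σ₀ γ₀ σ γ U Vb aff a B)
    (hnext : lcOf κ ^ 17 ≤ σ / (4 * lcOf κ ^ 10)) :
    ∃ (aff' : E3 → E3) (a' : Fin 2 → E3) (B' : E3 →L[ℝ] E3),
      ChainInv t A π c r c₀ aff₀ (lcOf κ) (phiOf Du r δ) ν Du Ustar Vstar b₀ j₀ σ₀ γ₀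
        (σ / (4 * lcOf κ ^ 10)) (lcOf κ ^ 10 * γ) (U + sAgg σ γ (phiOf Du r δ) Du r ν) (Vb + vAgg σ γ (phiOf Du r δ) Du r)
        aff' a' B' := by
  obtain ⟨hσ8, hσ64, hσr, hρr, hγ, hUmax, hVmax, hB', ha', hDu, hS⟩ :=
    inv_facts (aff₀ := aff₀) (aff := aff) (a := a) (B := B) hκ0 hκ1 hr SR hSR hc₀ hDu0 hν hγ₀ hδ hσ₀r hDu₀ C3 hinv
  obtain ⟨z₀, aT, BT, ξ, w, hz₀, hp₀c, hBT, -, hjump, hval, hξ, haff', hrel', hwfin, hW, henv⟩ :=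
    inv_scale_step hA hI (aff₀ := aff₀) (aff := aff) (a := a) (B := B) hκ0 hκ1 hκ hX hsep hequil hδ hδ1 hε0 hε hr hXb hπ hinj
      SR hSR hc₀ hDu0 hDu1 hν hγ₀ hN Cja hja Cjb CΛ hσ₀r hDu₀ C1 C2a C2b C2c C3 C4a hinv
  obtain ⟨haff, hrelax, hmass, hBle, hale, hdisp, hU0, hVb0, hpotU, hpotV, hσm, hσσ₀, hγ₀γ⟩ := hinv
  obtain ⟨hL, -, -⟩ := lcOf_ge hκ0 hκ1
  have hr0 : 0 < r := by linarith
  have hr1 : (1 : ℝ) ≤ r := by linarith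
  have hσ0 : 0 < σ := by linarith
  obtain ⟨hχ0, hχS, hχabs, hχ1abs, hχone, hχfar, hχfin⟩ := chainCutoff_props hA hI hr0 SR hSR
  set L := lcOf κ with hLdef
  have hL0 : 0 ≤ L := le_trans (by norm_num) hL
  have hL1 : 1 ≤ L := le_trans (by norm_num) hL
  set Φ := phiOf Du r δ with hΦdef
  have hΦ0 : 0 ≤ Φ := by rw [hΦdef]; unfold phiOf; positivity
  -- abbreviations of the two scales of the step
  set S : ℝ := γ * σ + σ ^ 2 * Φ + Du / (σ * r ^ 2) + σ ^ 2 * ν with hSdef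
  set V : ℝ := γ * σ ^ 3 + σ ^ 4 * Φ + σ ^ 2 * Du / r ^ 2 with hVdef
  have hS0 : 0 ≤ S := by rw [hSdef]; positivity
  have hV0 : 0 ≤ V := by rw [hVdef]; positivity
  have eS : sAgg σ γ Φ Du r ν = S := by rw [hSdef]; unfold sAgg; rfl
  have eV : vAgg σ γ Φ Du r = V := by rw [hVdef]; unfold vAgg; rfl
  -- the data thresholds and the Lipschitz modulus again
  have hj0 : 0 ≤ ‖a 0 - a 1‖ := norm_nonneg _
  have hb0 : 0 ≤ ‖B‖ := norm_nonneg _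
  have hΛle := lamOf_mono (Du := Du) ha' hB'
  have hΛ1 : lamOf Du ‖a 0 - a 1‖ ‖B‖ ≤ 1 := by linarith
  have hΛs : lamOf Du ‖a 0 - a 1‖ ‖B‖ ≤ Λs := hΛle.trans C4b
  have hΛ0 : 0 ≤ lamOf Du ‖a 0 - a 1‖ ‖B‖ := by unfold lamOf; positivity
  -- the increments in the root variables
  have hΘ₁ := sqrt_thetaOne_le (δ := δ) (ν := ν) hκ0 hκ1 hσ8 hσr hγ hr1 hδ hDu0 hj0 hb0 hΛ1 hν
  have hΘ₂ := sqrt_thetaTwo_le (δ := δ) (ν := ν) hκ0 hκ1 hσ8 hσr hγ hr1 hδ hDu0 hj0 hb0 hΛ1 hν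
  have hVsq := sqrt_vsq_le (δ := δ) hκ0 hκ1 hσ8 hσr hγ hr1 hδ hDu0 hj0 hb0 hΛ1
  have hJp := jump_le_root (δ := δ) (ν := ν) hκ0 hκ1 hσ8 hσr hγ hr1 hδ hDu0 hj0 hb0 hΛ1 hν
  have hXi := xi_le_root (δ := δ) (ν := ν) hκ0 hκ1 hσ8 hσr hγ hr1 hδ hDu0 hj0 hb0 hΛ1 hν
  rw [← hSdef] at hΘ₁ hJp hXi
  have hBTS : ‖BT‖ ≤ 12 * L ^ 8 * S := hBT.trans (by linarith)
  have hjumpS : ‖aT 0 - aT 1‖ ≤ L ^ 11 * S := hjump.trans hJp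
  have hξS : ‖ξ‖ ≤ L ^ 13 * S := hξ.trans hXi
  rw [← hVdef] at hVsq
  have hVa : ∀ m, ‖aT m‖ ≤ L ^ 8 * V + (66 / 5) * L ^ 8 * S := fun m => va_budget (hval m) hVsq hBTS
  have hVa0 : 0 ≤ L ^ 8 * V + (66 / 5) * L ^ 8 * S := by positivity
  have hK0 : 0 ≤ 1428 * Real.sqrt (thetaTwoOf κ (σ ^ 2) (γ ^ 2) r δ Du Du ‖a 0 - a 1‖ ‖B‖ (ν ^ 2 * r ^ 7)) := by positivity
  have hK : 1428 * Real.sqrt (thetaTwoOf κ (σ ^ 2) (γ ^ 2) r δ Du Du ‖a 0 - a 1‖ ‖B‖ (ν ^ 2 * r ^ 7)) ≤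
      1428 * L ^ 9 * (γ / σ + Φ + Du / (σ ^ 2 * r ^ 2) + σ ^ 2 * ν) := by
    have := mul_le_mul_of_nonneg_left hΘ₂ (by norm_num : (0 : ℝ) ≤ 1428)
    linarith
  -- the square sum of the correction in the root variables
  have hWroot : wsqOf κ (σ ^ 2) (γ ^ 2) r δ Du Du ‖a 0 - a 1‖ ‖B‖ ≤
      L ^ 12 * (γ ^ 2 + Λs ^ 2 * γ ^ 2 * σ ^ 12 + σ ^ 14 * Φ ^ 2 + σ ^ 8 * Du ^ 2 / r ^ 4) := by
    have h := wsqOf_le (δ := δ) hκ0 hκ1 hσ64 hσr (sq_nonneg γ) hr1 hDu0 hj0 hb0 hΛ1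
    refine h.trans (mul_le_mul_of_nonneg_left ?_ (by positivity))
    have hΛ2 : lamOf Du ‖a 0 - a 1‖ ‖B‖ ^ 2 ≤ Λs ^ 2 := pow_le_pow_left₀ hΛ0 hΛs 2
    have h0 : 0 ≤ γ ^ 2 * σ ^ 12 := by positivity
    have h1 := mul_le_mul_of_nonneg_right hΛ2 h0
    have e1 : lamOf Du ‖a 0 - a 1‖ ‖B‖ ^ 2 * γ ^ 2 * (σ ^ 2) ^ 6 = lamOf Du ‖a 0 - a 1‖ ‖B‖ ^ 2 * (γ ^ 2 * σ ^ 12) := by ring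
    have e2 : (σ ^ 2) ^ 7 * Φ ^ 2 = σ ^ 14 * Φ ^ 2 := by ring
    have e3 : (σ ^ 2) ^ 4 * Du ^ 2 / r ^ 4 = σ ^ 8 * Du ^ 2 / r ^ 4 := by ring
    have e4 : Λs ^ 2 * γ ^ 2 * σ ^ 12 = Λs ^ 2 * (γ ^ 2 * σ ^ 12) := by ring
    rw [e1, e2, e3, e4]; linarith [h1]
  -- the floors
  have hfloor : L ^ 114 * (σ₀ ^ 2 * Φ ^ 2 + Φ ^ 2 + σ₀ ^ 6 * ν ^ 2 + σ₀ ^ 2 * ν ^ 2 + ν ^ 2 + Du ^ 2 / r ^ 4) ≤ γ₀ ^ 2 := by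
    unfold floorAgg at C5; exact C5
  -- the new state
  refine ⟨fun x : E3 => aff x + ((if (∃ z ∈ Λ₀, x = t 1 + A z) then aT 1 else aT 0) + BT (x - (t 0 + A z₀))) +
      (if (∃ z ∈ Λ₀, x = t 0 + A z) then ξ else 0),
    (![a 0 + aT 0 + BT (c₀ - (t 0 + A z₀)) + ξ, a 1 + aT 1 + BT (c₀ - (t 0 + A z₀))] : Fin 2 → E3), B + BT, ?_⟩
  unfold ChainInv
  rw [eS, eV]
  refine ⟨haff', hrel', ?_, ?_, ?_, ?_, by positivity, by positivity, ?_, ?_, hnext, ?_, ?_⟩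
  · -- MASSES at the next scale
    intro Xr h1 hlo hhi
    have hlo' : σ ^ 2 / (16 * L ^ 20) ≤ Xr := by
      have e : (σ / (4 * L ^ 10)) ^ 2 = σ ^ 2 / (16 * L ^ 20) := by rw [div_pow]; ring
      rw [← e]; exact hlo
    by_cases hXσ : Xr ≤ σ ^ 2
    · -- fresh: the envelope
      have hf := fresh_mass_le hA hI (c₀ := c₀)
        (fun x : E3 => 𝛘[r / 2, r / 4] x • ((π x - x) - (aff x + ((if (∃ z ∈ Λ₀, x = t 1 + A z) then aT 1 else aT 0) +
          BT (x - (t 0 + A z₀))) + (if (∃ z ∈ Λ₀, x = t 0 + A z) then ξ else 0))))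
        w hwfin hK0 henv hW h1 hXσ
      exact hf.trans (fresh_total_le hL hσm hσσ₀ hγ₀ hγ₀γ hr1 hK0 hK (norm_nonneg ξ) hξS C4c hWroot hfloor hlo' hXσ)
    · -- propagated: triangle inequality
      push Not at hXσ
      have hp := propagated_mass_le hA hI (c₀ := c₀) (𝛘[r / 2, r / 4]) hχabs π aff aT BT ξ (t 0 + A z₀) hVa hp₀c h1 one_pos
      have e : (fun x : E3 => 𝛘[r / 2, r / 4] x • ((π x - x) - (aff x + (((if (∃ z ∈ Λ₀, x = t 1 + A z) then aT 1 else aT 0) +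
            BT (x - (t 0 + A z₀))) + (if (∃ z ∈ Λ₀, x = t 0 + A z) then ξ else 0))))) =
          (fun x : E3 => 𝛘[r / 2, r / 4] x • ((π x - x) - (aff x + ((if (∃ z ∈ Λ₀, x = t 1 + A z) then aT 1 else aT 0) +
            BT (x - (t 0 + A z₀))) + (if (∃ z ∈ Λ₀, x = t 0 + A z) then ξ else 0)))) := by
        funext x; simp only [add_assoc]
      rw [e] at hp
      have hold := hmass Xr h1 hXσ.le hhi
      refine hp.trans ?_
      have e2 : ((1 : ℝ) + 1) = 2 := by norm_num
      have e3 : ((1 : ℝ) + 1⁻¹) = 2 := by norm_num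
      rw [e2, e3]
      have hq := propagated_le hL hσm hσσ₀ hγ₀ hγ₀γ hΦ0 hν hDu0 hr1 hVa0 le_rfl (norm_nonneg ξ) hξS (norm_nonneg BT) hBTS
        hfloor hXσ.le
      linarith [hq, hold]
  · -- slope budget
    calc ‖B + BT‖ ≤ ‖B‖ + ‖BT‖ := norm_add_le _ _
      _ ≤ b₀ + 12 * L ^ 8 * U + 12 * L ^ 8 * S := add_le_add hBle hBTS
      _ = b₀ + 12 * L ^ 8 * (U + S) := by ring
  · -- sublattice jump budget
    have e : (![a 0 + aT 0 + BT (c₀ - (t 0 + A z₀)) + ξ, a 1 + aT 1 + BT (c₀ - (t 0 + A z₀))] : Fin 2 → E3) 0 -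
        (![a 0 + aT 0 + BT (c₀ - (t 0 + A z₀)) + ξ, a 1 + aT 1 + BT (c₀ - (t 0 + A z₀))] : Fin 2 → E3) 1 =
        (a 0 - a 1) + (aT 0 - aT 1) + ξ := by
      simp only [Matrix.cons_val_zero, Matrix.cons_val_one]; abel
    rw [e]
    have hL11 : L ^ 11 * S ≤ L ^ 13 * S := mul_le_mul_of_nonneg_right (pow_le_pow_right₀ hL1 (by norm_num)) hS0
    calc ‖(a 0 - a 1) + (aT 0 - aT 1) + ξ‖ ≤ ‖a 0 - a 1‖ + ‖aT 0 - aT 1‖ + ‖ξ‖ := norm_add₃_le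
      _ ≤ (j₀ + 2 * L ^ 13 * U) + L ^ 11 * S + L ^ 13 * S := add_le_add (add_le_add hale hjumpS) hξS
      _ ≤ j₀ + 2 * L ^ 13 * (U + S) := by linarith
  · -- displacement from the initial approximant
    intro x hx
    have h1 := hdisp x hx
    have hT : ‖(if (∃ z ∈ Λ₀, x = t 1 + A z) then aT 1 else aT 0) + BT (x - (t 0 + A z₀))‖ ≤
        (L ^ 8 * V + (66 / 5) * L ^ 8 * S) + 12 * L ^ 8 * S * (dist x c₀ + 11 / 10) := by
      refine (norm_add_le _ _).trans (add_le_add ?_ ?_)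
      · split_ifs
        · exact hVa 1
        · exact hVa 0
      · refine (BT.le_opNorm _).trans ?_
        have hd : ‖x - (t 0 + A z₀)‖ ≤ dist x c₀ + 11 / 10 := by
          rw [← dist_eq_norm]
          have := dist_triangle x c₀ (t 0 + A z₀)
          rw [dist_comm c₀ (t 0 + A z₀)] at this
          linarith
        exact mul_le_mul hBTS hd (norm_nonneg _) (by positivity)
    have hSξ : ‖(if (∃ z ∈ Λ₀, x = t 0 + A z) then ξ else 0)‖ ≤ L ^ 13 * S := by
      split_ifs
      · exact hξS
      · rw [norm_zero]; positivity
    have e : (aff x + ((if (∃ z ∈ Λ₀, x = t 1 + A z) then aT 1 else aT 0) + BT (x - (t 0 + A z₀))) +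
        (if (∃ z ∈ Λ₀, x = t 0 + A z) then ξ else 0)) - aff₀ x =
        (aff x - aff₀ x) + (((if (∃ z ∈ Λ₀, x = t 1 + A z) then aT 1 else aT 0) + BT (x - (t 0 + A z₀))) +
          (if (∃ z ∈ Λ₀, x = t 0 + A z) then ξ else 0)) := by abel
    rw [e]
    refine (norm_add_le _ _).trans ?_
    have h2 := (norm_add_le _ _).trans (add_le_add hT hSξ)
    exact disp_budget hL0 hS0 h1 h2
  · -- slope-type potential
    exact potU_step hL hσ8 hγ hΦ0 hν hDu0 hr0 hpotU
  · -- value-type potential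
    have hpotV' : Vb + 2 * (γ * σ ^ 3 + σ ^ 4 * Φ + σ ^ 2 * Du / r ^ 2) ≤ Vstar := by unfold vAgg at hpotV; exact hpotV
    have := potV_step (L := L) hL hσ0.le hγ hΦ0 hDu0 hr0 hpotV'
    unfold vAgg; exact this
  · -- range
    have : σ / (4 * L ^ 10) ≤ σ := by
      refine div_le_self hσ0.le ?_
      linarith [one_le_pow₀ (M₀ := ℝ) (n := 10) hL1]
    exact this.trans hσσ₀
  · exact hγ₀γ.trans (le_mul_of_one_le_left hγ (one_le_pow₀ hL1))

end

end Summit.AtomisticToContinuum.Crystallization.Theorems.ExcessDecayLiouville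

end
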